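import Summits.AnomalousDissipation.AnomalousDissipation.Theorems.SawtoothPulseCascadeK1LocalisedCascadeAxisBlock
import Literature.Analysis.FunctionSpaces.TorusSpectralWeakDerivative

/-!
# K1loc, line `Spectral` — S-D (thin start): FAR MODES ALONG AN AXIS ARE CONTROLLED BY ONE PARTIAL DERIVATIVE

Helper file of the prover lane on the crux `K1LocalisedCascade` (stmt-AnomalousDissipation-19491), route
`SawtoothPulseCascade` (glue seat k1loc-p3; S-B ↔ S-D hand-over).  The tracked set of the thin-start ledger at the hand-over
phase `n` (`…K1Ledger.From.k1Localised_of_thin_iterate_bound` / `…k1Localised_of_thin_released_energy`) is the complement of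
`G_n = {|k₀| ≥ 1.004·c·rⁿ} ∩ cone ∩ {|k|∞ ≤ R_n}`, so besides the strip (`…StripAverage`) and the steep cone it contains the
FAR modes `{|kⱼ| > R_n}` beyond the envelope.  Their energy is elementary: by `𝓕(∂ⱼθ)(k) = 2πi kⱼ 𝓕θ(k)` and Parseval,
**`Σ' k, [R ≤ |kⱼ|]·‖𝓕θ(k)‖² ≤ ∫(∂ⱼθ)²/(2πR)² ≤ (D/(2πR))²`** for a smooth real `θ` with `|∂ⱼθ| ≤ D`
(`tsum_far_le_partialDeriv`, `tsum_far_le_of_abs_partialDeriv_le`, weighted forms); for the inviscid iterate `D = 2π(1+γ)^{2n}`-type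
(`…IterateGradient.abs_partialDeriv_iterate_le`) against `R_n = 2c(Γ(γ²−3)/ρ₀)ⁿ`, a geometrically small channel.
WHAT THIS IS NOT: no statement about the cascade. [cite: Grafakos2014, Prop. 3.2.6 (8) and Prop. 3.2.7 (3)] [problem: turb]
-/

-- `Summit.<Summit>.<Problem>`: single-conjunct summit, the duplicate namespace segment is deliberate.
set_option linter.dupNamespace false

noncomputable section

namespace Summit.AnomalousDissipation.AnomalousDissipation.Theorems.SawtoothPulseCascade.K1Start

open MeasureTheory Set Filter Topology UnitAddTorus Function
open Literature.Analysis.FunctionSpaces Literature.Analysis.FunctionSpaces.Torus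

variable {d : Type*} [Fintype d] [DecidableEq d]

/-- **Parseval for one partial derivative**: `Σ_k (2πkⱼ)²‖𝓕θ(k)‖² = ∫ (∂ⱼθ)²` for smooth real `θ`.
[cite: Grafakos2014, Prop. 3.2.6 (8) and Prop. 3.2.7 (3)] -/
theorem hasSum_sq_mul_sq_mFourierCoeff_partialDeriv {θ : UnitAddTorus d → ℝ} (hθ : IsSmooth θ) (j : d) :
    HasSum (fun k : d → ℤ => (2 * Real.pi * (k j : ℝ)) ^ 2 * ‖mFourierCoeff (fun x => (θ x : ℂ)) k‖ ^ 2)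
      (∫ x, (partialDeriv j θ x) ^ 2) := by
  have hΘ : IsSmooth (fun x => (θ x : ℂ)) := hθ.ofReal_comp
  have hg : IsSmooth (partialDeriv j (fun x => (θ x : ℂ))) := hΘ.partialDeriv j
  have hP := hasSum_sq_mFourierCoeff_of_continuous hg.continuous
  have hint : ∫ x, ‖partialDeriv j (fun x => (θ x : ℂ)) x‖ ^ 2 = ∫ x, (partialDeriv j θ x) ^ 2 := by
    refine integral_congr_ae (Eventually.of_forall fun x => ?_)
    simp only [partialDeriv_ofReal_comp hθ j x, Complex.norm_real, Real.norm_eq_abs, sq_abs]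
  rw [hint] at hP
  refine hP.congr_fun fun k => ?_
  have hn : ‖(2 * Real.pi * Complex.I * (k j) : ℂ)‖ = |2 * Real.pi * (k j : ℝ)| := by
    rw [show (2 * Real.pi * Complex.I * (k j) : ℂ) = ((2 * Real.pi * (k j : ℝ) : ℝ) : ℂ) * Complex.I by push_cast; ring,
      norm_mul, Complex.norm_I, mul_one, Complex.norm_real, Real.norm_eq_abs]
  rw [mFourierCoeff_partialDeriv hΘ j k, norm_smul, hn, ← sq_abs (2 * Real.pi * (k j : ℝ))]
  ring

/-- **Far modes along the `j`-th axis**: `Σ' k, [R ≤ |kⱼ|]·‖𝓕θ(k)‖² ≤ (1/(2πR))²·∫(∂ⱼθ)²` (`R > 0`, `θ` smooth real).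
[cite: Grafakos2014, Prop. 3.2.6 (8) and Prop. 3.2.7 (3)] -/
theorem tsum_far_le_partialDeriv {θ : UnitAddTorus d → ℝ} (hθ : IsSmooth θ) (j : d) {R : ℝ} (hR : 0 < R) :
    ∑' k : d → ℤ, (if R ≤ |((k j : ℤ) : ℝ)| then (1 : ℝ) else 0) * ‖mFourierCoeff (fun x => (θ x : ℂ)) k‖ ^ 2 ≤
      (1 / (2 * Real.pi * R)) ^ 2 * ∫ x, (partialDeriv j θ x) ^ 2 := by
  have hD := hasSum_sq_mul_sq_mFourierCoeff_partialDeriv hθ j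
  have hle : ∀ k : d → ℤ, (if R ≤ |((k j : ℤ) : ℝ)| then (1 : ℝ) else 0) * ‖mFourierCoeff (fun x => (θ x : ℂ)) k‖ ^ 2 ≤
      (1 / (2 * Real.pi * R)) ^ 2 * ((2 * Real.pi * (k j : ℝ)) ^ 2 * ‖mFourierCoeff (fun x => (θ x : ℂ)) k‖ ^ 2) := by
    intro k
    rw [← mul_assoc]
    refine mul_le_mul_of_nonneg_right ?_ (sq_nonneg _)
    split_ifs with hk
    · have h1 : 1 ≤ |((k j : ℤ) : ℝ)| / R := by rw [le_div_iff₀ hR, one_mul]; exact hk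
      have h2 : (1 : ℝ) ≤ (|((k j : ℤ) : ℝ)| / R) ^ 2 := by nlinarith
      calc (1 : ℝ) ≤ (|((k j : ℤ) : ℝ)| / R) ^ 2 := h2
        _ = (1 / (2 * Real.pi * R)) ^ 2 * (2 * Real.pi * (k j : ℝ)) ^ 2 := by
            rw [div_pow, div_pow, sq_abs]; field_simp
    · positivity
  have hsum2 : Summable fun k : d → ℤ =>
      (1 / (2 * Real.pi * R)) ^ 2 * ((2 * Real.pi * (k j : ℝ)) ^ 2 * ‖mFourierCoeff (fun x => (θ x : ℂ)) k‖ ^ 2) :=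
    hD.summable.mul_left _
  have hnn : ∀ k : d → ℤ, 0 ≤ (if R ≤ |((k j : ℤ) : ℝ)| then (1 : ℝ) else 0) * ‖mFourierCoeff (fun x => (θ x : ℂ)) k‖ ^ 2 :=
    fun k => mul_nonneg (by split_ifs <;> norm_num) (sq_nonneg _)
  have hsum1 := Summable.of_nonneg_of_le hnn hle hsum2
  calc ∑' k : d → ℤ, (if R ≤ |((k j : ℤ) : ℝ)| then (1 : ℝ) else 0) * ‖mFourierCoeff (fun x => (θ x : ℂ)) k‖ ^ 2
      ≤ ∑' k : d → ℤ, (1 / (2 * Real.pi * R)) ^ 2 *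
          ((2 * Real.pi * (k j : ℝ)) ^ 2 * ‖mFourierCoeff (fun x => (θ x : ℂ)) k‖ ^ 2) :=
        Summable.tsum_le_tsum hle hsum1 hsum2
    _ = (1 / (2 * Real.pi * R)) ^ 2 * ∫ x, (partialDeriv j θ x) ^ 2 := by rw [tsum_mul_left, hD.tsum_eq]

/-- **Far modes from a sup bound on the partial derivative**: `|∂ⱼθ| ≤ D` pointwise gives
`Σ' k, [R ≤ |kⱼ|]·‖𝓕θ(k)‖² ≤ (D/(2πR))²`. [cite: Grafakos2014, Prop. 3.2.6 (8) and Prop. 3.2.7 (3)] -/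
theorem tsum_far_le_of_abs_partialDeriv_le {θ : UnitAddTorus d → ℝ} (hθ : IsSmooth θ) (j : d) {R D : ℝ} (hR : 0 < R)
    (hD : ∀ x, |partialDeriv j θ x| ≤ D) :
    ∑' k : d → ℤ, (if R ≤ |((k j : ℤ) : ℝ)| then (1 : ℝ) else 0) * ‖mFourierCoeff (fun x => (θ x : ℂ)) k‖ ^ 2 ≤
      (D / (2 * Real.pi * R)) ^ 2 := by
  have hD0 : 0 ≤ D := (abs_nonneg _).trans (hD 0)
  have hint : ∫ x, (partialDeriv j θ x) ^ 2 ≤ D ^ 2 := by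
    have h1 : ∫ x, (partialDeriv j θ x) ^ 2 ≤ ∫ x : UnitAddTorus d, D ^ 2 := by
      refine integral_mono_of_nonneg (Eventually.of_forall fun x => sq_nonneg _) (integrable_const _)
        (Eventually.of_forall fun x => ?_)
      show (partialDeriv j θ x) ^ 2 ≤ D ^ 2
      rw [← sq_abs]
      exact pow_le_pow_left₀ (abs_nonneg _) (hD x) 2
    rwa [integral_const, probReal_univ, one_smul] at h1
  calc _ ≤ (1 / (2 * Real.pi * R)) ^ 2 * ∫ x, (partialDeriv j θ x) ^ 2 := tsum_far_le_partialDeriv hθ j hR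
    _ ≤ (1 / (2 * Real.pi * R)) ^ 2 * D ^ 2 := mul_le_mul_of_nonneg_left hint (sq_nonneg _)
    _ = (D / (2 * Real.pi * R)) ^ 2 := by ring

/-- **Weighted form** (the off-envelope part of a tracked symbol): for `0 ≤ w ≤ [R ≤ |kⱼ|]` and `|∂ⱼθ| ≤ D`,
`Σ' k, w(k)·‖𝓕θ(k)‖² ≤ (D/(2πR))²`. [cite: Grafakos2014, Prop. 3.2.6 (8) and Prop. 3.2.7 (3)] -/
theorem tsum_weight_far_le {θ : UnitAddTorus d → ℝ} (hθ : IsSmooth θ) (j : d) {R D : ℝ} (hR : 0 < R)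
    (hD : ∀ x, |partialDeriv j θ x| ≤ D) {w : (d → ℤ) → ℝ} (hw0 : ∀ k, 0 ≤ w k) (hw1 : ∀ k, w k ≤ 1)
    (hwR : ∀ k, |((k j : ℤ) : ℝ)| < R → w k = 0) :
    ∑' k : d → ℤ, w k * ‖mFourierCoeff (fun x => (θ x : ℂ)) k‖ ^ 2 ≤ (D / (2 * Real.pi * R)) ^ 2 := by
  have hle : ∀ k : d → ℤ, w k * ‖mFourierCoeff (fun x => (θ x : ℂ)) k‖ ^ 2 ≤
      (if R ≤ |((k j : ℤ) : ℝ)| then (1 : ℝ) else 0) * ‖mFourierCoeff (fun x => (θ x : ℂ)) k‖ ^ 2 := by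
    intro k
    refine mul_le_mul_of_nonneg_right ?_ (sq_nonneg _)
    split_ifs with hk
    · exact hw1 k
    · exact (hwR k (not_le.mp hk)).le
  have hΘc : Continuous (fun x => (θ x : ℂ)) := Complex.continuous_ofReal.comp hθ.continuous
  have hsumI : Summable fun k : d → ℤ =>
      (if R ≤ |((k j : ℤ) : ℝ)| then (1 : ℝ) else 0) * ‖mFourierCoeff (fun x => (θ x : ℂ)) k‖ ^ 2 := by
    refine Summable.of_nonneg_of_le (fun k => by positivity) (fun k => ?_)
      (hasSum_sq_mFourierCoeff_of_continuous hΘc).summable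
    split_ifs <;> simp
  have hsumw : Summable fun k : d → ℤ => w k * ‖mFourierCoeff (fun x => (θ x : ℂ)) k‖ ^ 2 :=
    Summable.of_nonneg_of_le (fun k => mul_nonneg (hw0 k) (sq_nonneg _)) hle hsumI
  exact (Summable.tsum_le_tsum hle hsumw hsumI).trans (tsum_far_le_of_abs_partialDeriv_le hθ j hR hD)

end Summit.AnomalousDissipation.AnomalousDissipation.Theorems.SawtoothPulseCascade.K1Start
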